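import Mathlib
import Summits.RiemannHypothesis.RiemannHypothesis.Theorems.JensenPolynomialsDefs
import Summits.RiemannHypothesis.RiemannHypothesis.Theorems.JensenPolynomialsCumulantDefs
import Literature.Analysis.Complex.LogTaylorCaratheodory

/-!
# Route `JensenPolynomials` — G1: the window cumulants from a zero-free disc of the window EGF (ξ-free, RH-FREE)

Support **G1 `WindowCumulantOfZeroFree`** of the theory seat's β″ split of the ANALYTIC crux `XiGorttwCoeffSmallAnalytic`
(THEORY-JENSEN.md §10.10 (10); route-prep `JensenWindowEGFGlue.lean`), PROVED for every real sequence `γ`: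
if the window EGF polynomial `F_M(s) = 1 + Σ_{k=1}^{M} r̃_k(M) s^k/k!` (`r̃_k = windowSeqDown γ M k`) has no zero on
`‖s‖ ≤ θM` and `log ‖F_M(s)·e^{−P(s)}‖ ≤ B` there, `P(s) = s − d₂s² + u₃s³/6` any cubic (the route takes
`d₂ = Δ(M)²`, `u₃ = ũ₃(M)`: `windowCubic`), then the window cumulants (`windowCumulant`, `JensenPolynomialsCumulantDefs`)
satisfy `|ũ_k(M)| ≤ 2·k!·B/(θM)^k` for `4 ≤ k ≤ M` — `windowCumulant_abs_le_of_zeroFree`.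

Proof: the holomorphic logarithm `g` of `F_Me^{−P}` on the disc and CARATHÉODORY'S INEQUALITY `‖g⁽ᵏ⁾(0)‖ ≤ 2Bk!/R^k`
(`Literature.Analysis.Complex.exists_log_taylor_recursion`, from the coefficient form of Borel–Carathéodory,
`Literature/Analysis/Complex/CaratheodoryCoefficient.lean`); the Taylor coefficients of `g + P` satisfy the same
moment–cumulant recursion as `windowCumulant` (Leibniz rule on `F′ = (g+P)′F` and `F⁽ʲ⁾(0) = r̃_j`), hence coincide
with `ũ_k` for `k ≤ M` (`cumulant_unique`); the cubic `P` does not contribute from order `4` on.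
The statement is written with the window EGF and the cubic spelled out (no new definitions); it is literally the
hypothesis/conclusion shape of `WindowCumulantOfZeroFree` once `windowEGFPoly`/`windowCubic` (theory port
`JensenWindowEGF.lean`) are unfolded (`Polynomial.eval` of `1 + Σ C(r̃_k/k!)X^k`).  Cell rh-jensen (HUMAN RULING D-0040).
WHAT THIS IS NOT: pure complex analysis + algebra for ANY sequence; nothing about `ξ` or the zeros of `ζ`.
-/

noncomputable section
-- D-0017: `Summit.RiemannHypothesis.RiemannHypothesis.…` duplicates the namespace BY DESIGN (single-problem summit).
set_option linter.dupNamespace false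

open Complex Metric Set Filter
open scoped Real Nat Topology

namespace Summit.RiemannHypothesis.RiemannHypothesis.Theorems.JensenPolynomials

open Literature.NumberTheory.LFunctions Literature.Analysis.Complex
/-- The moment–cumulant recursion determines the cumulants: abstract uniqueness. (used with `r = windowSeqDown γ M`, `u = windowCumulant γ M`). -/
theorem cumulant_unique {M : ℕ} (r u : ℕ → ℝ) (κ m : ℕ → ℂ)
    (hu : ∀ k, u (k + 1) = r (k + 1) - ∑ i : Fin k, (k.choose i.1 : ℝ) * u (i.1 + 1) * r (k - i.1))
    (hm0 : m 0 = 1) (hm : ∀ j, 1 ≤ j → j ≤ M → m j = (r j : ℂ))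
    (hrec : ∀ k, k + 1 ≤ M →
      m (k + 1) = ∑ i ∈ Finset.range (k + 1), (k.choose i : ℂ) * κ (i + 1) * m (k - i)) :
    ∀ j, 1 ≤ j → j ≤ M → κ j = (u j : ℂ) := by
  intro j
  induction j using Nat.strong_induction_on with
  | _ j ih =>
    intro hj1 hjM
    obtain ⟨k, rfl⟩ : ∃ k, j = k + 1 := ⟨j - 1, by omega⟩
    have h := hrec k hjM
    rw [Finset.sum_range_succ, Nat.choose_self, Nat.sub_self, hm0, Nat.cast_one, one_mul, mul_one,
      hm (k + 1) hj1 hjM] at h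
    -- h : r (k+1) = (∑ i < k, C(k,i) κ(i+1) m(k-i)) + κ (k+1)
    have hs : ∑ i ∈ Finset.range k, (k.choose i : ℂ) * κ (i + 1) * m (k - i) =
        ∑ i ∈ Finset.range k, (k.choose i : ℂ) * (u (i + 1) : ℂ) * (r (k - i) : ℂ) := by
      refine Finset.sum_congr rfl fun i hi => ?_
      have hik : i < k := Finset.mem_range.mp hi
      rw [ih (i + 1) (by omega) (by omega) (by omega), hm (k - i) (by omega) (by omega)]
    rw [hs] at h
    rw [hu k]
    push_cast
    rw [Fin.sum_univ_eq_sum_range (fun i => (k.choose i : ℂ) * (u (i + 1) : ℂ) * (r (k - i) : ℂ)) k]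
    linear_combination -h


/-- `1 + Σ_{k ∈ Icc 1 M} c_k s^k = Σ_{j < M+1} a_j s^j` with `a_0 = 1`, `a_j = c_j`. [folklore] -/
theorem one_add_sum_Icc_eq_sum_range (c : ℕ → ℂ) (M : ℕ) (s : ℂ) :
    1 + ∑ k ∈ Finset.Icc 1 M, c k * s ^ k =
      ∑ j ∈ Finset.range (M + 1), (if j = 0 then 1 else c j) * s ^ j := by
  induction M with
  | zero => simp
  | succ M ih =>
    rw [Finset.sum_range_succ, ← ih, ← Finset.insert_Icc_right_eq_Icc_add_one (by omega : 1 ≤ M + 1),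
      Finset.sum_insert (by simp), if_neg (by omega)]
    ring

/-- **G1 — the window cumulants from a zero-free disc (ξ-free; Borel–Carathéodory + the moment–cumulant
recursion).** For any real sequence `γ`, `M ≥ 1`, `θ > 0`: if the window EGF polynomial
`F_M(s) = 1 + Σ_{k=1}^{M} r̃_k(M) s^k/k!` has no zero on `‖s‖ ≤ θM` and `log ‖F_M(s)e^{−P₃(s)}‖ ≤ B` there
(`P₃(s) = s − Δ²s² + ũ₃s³/6`), then `|ũ_k(M)| ≤ 2·k!·B/(θM)^k` for `4 ≤ k ≤ M`. [cite: Titchmarsh1939, §5.5] -/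
theorem windowCumulant_abs_le_of_zeroFree (γ : ℕ → ℝ) (M : ℕ) (θ B d2 u3 : ℝ) (hθ : 0 < θ) (hM : 1 ≤ M)
    (hzf : ∀ s : ℂ, ‖s‖ ≤ θ * M →
      (1 + ∑ k ∈ Finset.Icc 1 M, (((windowSeqDown γ M k / (k ! : ℝ) : ℝ)) : ℂ) * s ^ k) ≠ 0 ∧
        Real.log ‖(1 + ∑ k ∈ Finset.Icc 1 M, (((windowSeqDown γ M k / (k ! : ℝ) : ℝ)) : ℂ) * s ^ k) *
          Complex.exp (-(s - ((d2 : ℝ) : ℂ) * s ^ 2 + ((u3 : ℝ) : ℂ) * s ^ 3 / 6))‖ ≤ B) :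
    ∀ k : ℕ, 4 ≤ k → k ≤ M → |windowCumulant γ M k| ≤ 2 * (k ! : ℝ) * B / (θ * M) ^ k := by
  set R : ℝ := θ * M with hRdef
  have hR : 0 < R := mul_pos hθ (by exact_mod_cast (show 0 < M by omega))
  set c : ℕ → ℂ := fun k => (((windowSeqDown γ M k / (k ! : ℝ) : ℝ)) : ℂ) with hc
  set a : ℕ → ℂ := fun j => if j = 0 then 1 else c j with ha
  have ha0 : a 0 = 1 := by simp [ha]
  set P : ℂ → ℂ := fun s => s - ((d2 : ℝ) : ℂ) * s ^ 2 + ((u3 : ℝ) : ℂ) * s ^ 3 / 6 with hPdef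
  set P' : ℂ → ℂ := fun s => 1 - ((d2 : ℝ) : ℂ) * (2 * s) + ((u3 : ℝ) : ℂ) * (3 * s ^ 2) / 6 with hP'def
  have hP : ∀ s, HasDerivAt P (P' s) s := by
    intro s
    have h1 := hasDerivAt_id s
    have h2 := (hasDerivAt_pow 2 s).const_mul (((d2 : ℝ) : ℂ))
    have h3 := ((hasDerivAt_pow 3 s).const_mul (((u3 : ℝ) : ℂ))).div_const 6
    have h := (h1.sub h2).add h3
    refine h.congr_deriv ?_
    simp only [hP'def]; push_cast; ring
  have hP' : Differentiable ℂ P' := by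
    intro s
    have h := ((hasDerivAt_const s (1 : ℂ)).sub (((hasDerivAt_id s).const_mul (2 : ℂ)).const_mul
      (((d2 : ℝ) : ℂ)))).add ((((hasDerivAt_pow 2 s).const_mul (3 : ℂ)).const_mul
      (((u3 : ℝ) : ℂ))).div_const 6)
    exact h.differentiableAt
  have hP0 : P 0 = 0 := by simp [hPdef]
  have hFeq : ∀ s : ℂ, 1 + ∑ k ∈ Finset.Icc 1 M, c k * s ^ k = ∑ j ∈ Finset.range (M + 1), a j * s ^ j :=
    fun s => one_add_sum_Icc_eq_sum_range c M s
  have hne : ∀ s ∈ Metric.ball (0 : ℂ) R, (∑ j ∈ Finset.range (M + 1), a j * s ^ j) ≠ 0 := by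
    intro s hs
    rw [← hFeq]
    exact (hzf s (le_of_lt (mem_ball_zero_iff.mp hs))).1
  have hB : ∀ s ∈ Metric.ball (0 : ℂ) R,
      Real.log ‖(∑ j ∈ Finset.range (M + 1), a j * s ^ j) * Complex.exp (-(P s))‖ ≤ B := by
    intro s hs
    rw [← hFeq]
    exact (hzf s (le_of_lt (mem_ball_zero_iff.mp hs))).2
  obtain ⟨g, hg0, hgd, hbound, hrec⟩ := exists_log_taylor_recursion a M ha0 hP hP' hP0 hR hne hB
  -- identification of the Taylor coefficients of g + P with the window cumulants
  set κ : ℕ → ℂ := fun j => iteratedDeriv j (fun s => g s + P s) 0 with hκ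
  have hm : ∀ j, 1 ≤ j → j ≤ M → a j * (j ! : ℂ) = ((windowSeqDown γ M j : ℝ) : ℂ) := by
    intro j hj _
    simp only [ha, hc, if_neg (show j ≠ 0 by omega)]
    have hj0 : (j ! : ℂ) ≠ 0 := by exact_mod_cast (Nat.factorial_pos j).ne'
    push_cast
    rw [div_mul_cancel₀ _ hj0]
  have hident : ∀ j, 1 ≤ j → j ≤ M → κ j = ((windowCumulant γ M j : ℝ) : ℂ) := by
    refine cumulant_unique (windowSeqDown γ M) (windowCumulant γ M) κ (fun j => a j * (j ! : ℂ))
      (fun k => by rw [windowCumulant]) (by simp [ha0]) hm ?_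
    intro k hk
    rw [hrec k hk]
  -- the cubic does not contribute from order 4 on
  set b : ℕ → ℂ := fun j => if j = 1 then 1 else if j = 2 then -((d2 : ℝ) : ℂ)
    else if j = 3 then ((u3 : ℝ) : ℂ) / 6 else 0 with hb
  have hPsum : P = fun s => ∑ j ∈ Finset.range (3 + 1), b j * s ^ j := by
    funext s
    simp only [hPdef, hb, Finset.sum_range_succ, Finset.sum_range_zero]
    norm_num
    ring
  have hPk : ∀ k, 4 ≤ k → iteratedDeriv k P 0 = 0 := by
    intro k hk
    rw [hPsum, iteratedDeriv_sum_pow_zero b 3 k, if_neg (by omega)]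
  have hball : Metric.ball (0 : ℂ) R ∈ nhds (0 : ℂ) := Metric.isOpen_ball.mem_nhds (Metric.mem_ball_self hR)
  have hgC : ∀ k : ℕ, ContDiffAt ℂ k g 0 := fun k => (hgd.contDiffOn Metric.isOpen_ball).contDiffAt hball
  have hPdiff : Differentiable ℂ P := fun s => (hP s).differentiableAt
  have hPC : ∀ k : ℕ, ContDiffAt ℂ k P 0 := fun k => (hPdiff.contDiff (n := k)).contDiffAt
  intro k hk4 hkM
  have h1 : κ k = iteratedDeriv k g 0 := by
    simp only [hκ]
    rw [iteratedDeriv_fun_add (hgC k) (hPC k), hPk k hk4, add_zero]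
  have h2 := hident k (by omega) hkM
  have h3 := hbound k (by omega)
  rw [← h1, h2, Complex.norm_real, Real.norm_eq_abs] at h3
  calc |windowCumulant γ M k| ≤ 2 * B * (k ! : ℝ) / R ^ k := h3
    _ = 2 * (k ! : ℝ) * B / (θ * M) ^ k := by rw [hRdef]; ring

end Summit.RiemannHypothesis.RiemannHypothesis.Theorems.JensenPolynomials

end
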